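import Summits.AnomalousDissipation.AnomalousDissipation.Theorems.SolenoidalFractalHomogenisationLagrangianCarrierConstructionEnvelopes
import Literature.Analysis.FunctionSpaces.HolderNormTorusProofs
import Literature.Analysis.ODE.EvolutionMap
import HarnessLib

/-!
# K3L `LagrangianCarrierConstruction` (stmt-AnomalousDissipation-24913), line `birth`, stub `stub_flowsL`:
# the lifted Eulerian level fields are admissible for the flow calculus (helper; `--supports stmt-AnomalousDissipation-24913`)

Summits-side helper file (everything proved; no definitions, no named facts). Third brick of the Lagrangian insertion
`stub_flowsL`. The Eulerian level field `level m` of a fractal-carrier datum `D` (shear rate `a_m`, cells `1/N_m`, the word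
`D.word m` replayed quasi-statically), lifted to `ℝ³` along the covering map, `v t z := D.level m t (proj z)`, is shown to be
* lattice periodic in `z` (so its evolution maps are lattice equivariant, `…FlowSmooth.evolutionMap_add_latticeVec`);
* bounded, continuous in `t` for each `z`, and Lipschitz in `z` with one constant for all times — hence it satisfies the
  Cauchy–Lipschitz hypotheses `IsUniformlyLipschitzOn v univ` of the tree's evolution map on the whole time axis;
* `C^n` (every `n`) on the one-sided time slabs `[r, r + ε] × ℝ³` and `[r − ε, r] × ℝ³` around EVERY time `r`: there the
  slot envelopes are affine (`…Envelopes.exists_affine_envelopes_right/left`), so the field is a finite sum of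
  (affine in `t`) × (trigonometric in `z`) terms.
These are exactly the hypotheses under which `…FlowSmooth` makes every evolution map `z ↦ φ(t, s, z)` of `v` a lattice-equivariant
`C^n` diffeomorphism, jointly `C^n` in `(t, z)` away from the envelope corners. Infrastructure for the construction side of
route-1's rung leaf F-D1.A0 (a frontier formal rung); NOT a proof of anomalous dissipation.
-/

set_option linter.dupNamespace false

noncomputable section

namespace Summit.AnomalousDissipation.AnomalousDissipation.Theorems.SolenoidalFractalHomogenisation.LagrangianCarrierConstruction

open Set Function Filter Topology
open scoped NNReal ContDiff
open Literature.Analysis Literature.Analysis.FunctionSpaces Literature.Analysis.FunctionSpaces.Torus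
open Literature.Analysis.FluidPDE Literature.Analysis.FluidPDE.LatticeShear
open Literature.Analysis.ODE
open Summit.AnomalousDissipation.AnomalousDissipation.Theorems.SolenoidalFractalHomogenisation.PermissibleCarrier
  (level_eq_smul carrier_nsmul_apply lipschitzWith_layerComb sum_abs_trapezoid_le isSmooth_layer_nsmul
    continuous_trapezoid_fract norm_level_le)

variable {k : ℕ}

/-- The lifted level field as an explicit envelope-weighted sum of lifted layers:
`level m t (proj z) = (a_m/N_m) • Σⱼ envⱼ(a_m t) • layerⱼ(N_m • proj z)`. [cite: ArmstrongVicol2025, §3 (alternating-shear fractal carrier)] -/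
theorem level_proj_eq_sum (D : FractalCarrierData k) (m : ℕ) (t : ℝ) (z : EuclideanSpace ℝ (Fin 3)) :
    D.level m t (proj z) = (D.a m / (D.N m : ℝ)) • ∑ j, LatticeWord.trapezoid ((D.word m).start j)
      ((D.word m).phase j).τ (D.word m).ramp (Int.fract (D.a m * t / (D.word m).period) * (D.word m).period) •
        ((D.word m).phase j).layer (D.N m • proj z) := by
  rw [level_eq_smul, Pi.smul_apply, carrier_nsmul_apply]

/-- The lifted level field is lattice periodic in space. [folklore] -/
theorem level_proj_add_latticeVec (D : FractalCarrierData k) (m : ℕ) (t : ℝ) (z : EuclideanSpace ℝ (Fin 3))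
    (n : Fin 3 → ℤ) : D.level m t (proj (z + latticeVec n)) = D.level m t (proj z) := by
  rw [proj_add_latticeVec]

/-- The lifted level field is continuous in time at every point. [folklore] -/
theorem continuous_level_proj (D : FractalCarrierData k) (m : ℕ) (z : EuclideanSpace ℝ (Fin 3)) :
    Continuous fun t => D.level m t (proj z) := by
  have e : (fun t => D.level m t (proj z)) = fun t => (D.a m / (D.N m : ℝ)) • ∑ j,
      LatticeWord.trapezoid ((D.word m).start j) ((D.word m).phase j).τ (D.word m).ramp
        (Int.fract (D.a m * t / (D.word m).period) * (D.word m).period) • ((D.word m).phase j).layer (D.N m • proj z) :=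
    funext fun t => level_proj_eq_sum D m t z
  rw [e]
  have hsum : Continuous fun t : ℝ => ∑ j, LatticeWord.trapezoid ((D.word m).start j) ((D.word m).phase j).τ
      (D.word m).ramp (Int.fract (D.a m * t / (D.word m).period) * (D.word m).period) •
        ((D.word m).phase j).layer (D.N m • proj z) :=
    continuous_finsetSum Finset.univ fun j _ =>
      (continuous_trapezoid_fract (D.word m) j (D.a m)).smul continuous_const
  exact (continuous_const : Continuous fun _ : ℝ => D.a m / (D.N m : ℝ)).smul hsum

/-- The lifted level field is Lipschitz in space with one constant for all times
(`(a_m/N_m) · 3√3 k N_m`, from the layer-combination bound and the `1`-Lipschitz covering map). [folklore] -/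
theorem lipschitzWith_level_proj (D : FractalCarrierData k) (m : ℕ) (t : ℝ) :
    LipschitzWith (‖D.a m / (D.N m : ℝ)‖₊ * (NNReal.sqrt 3 * (3 * ((k : ℝ).toNNReal * D.N m))) * 1)
      fun z : EuclideanSpace ℝ (Fin 3) => D.level m t (proj z) := by
  have hfun : (fun z : EuclideanSpace ℝ (Fin 3) => D.level m t (proj z)) =
      (fun y => (D.a m / (D.N m : ℝ)) • y) ∘ (fun x : UnitAddTorus (Fin 3) => ∑ j,
        LatticeWord.trapezoid ((D.word m).start j) ((D.word m).phase j).τ (D.word m).ramp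
          (Int.fract (D.a m * t / (D.word m).period) * (D.word m).period) •
        ((D.word m).phase j).layer (D.N m • x)) ∘ (proj : EuclideanSpace ℝ (Fin 3) → UnitAddTorus (Fin 3)) := by
    funext z
    simp only [comp_apply, level_proj_eq_sum]
  rw [hfun]
  have hcomb := lipschitzWith_layerComb (D.word m) (fun j => LatticeWord.trapezoid ((D.word m).start j)
    ((D.word m).phase j).τ (D.word m).ramp (Int.fract (D.a m * t / (D.word m).period) * (D.word m).period)) (D.N m)
  have hsum : (∑ j, |LatticeWord.trapezoid ((D.word m).start j) ((D.word m).phase j).τ (D.word m).ramp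
      (Int.fract (D.a m * t / (D.word m).period) * (D.word m).period)|).toNNReal ≤ (k : ℝ).toNNReal :=
    Real.toNNReal_le_toNNReal (sum_abs_trapezoid_le _ _)
  have hle : NNReal.sqrt 3 * (3 * ((∑ j, |LatticeWord.trapezoid ((D.word m).start j) ((D.word m).phase j).τ
      (D.word m).ramp (Int.fract (D.a m * t / (D.word m).period) * (D.word m).period)|).toNNReal * (D.N m : ℝ≥0))) ≤
      NNReal.sqrt 3 * (3 * ((k : ℝ).toNNReal * (D.N m : ℝ≥0))) := by gcongr
  exact ((lipschitzWith_smul (D.a m / (D.N m : ℝ))).comp (hcomb.weaken hle)).comp lipschitzWith_proj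

/-- **The lifted level field satisfies the Cauchy–Lipschitz hypotheses on the whole time axis.** [folklore] -/
theorem isUniformlyLipschitzOn_level_proj (D : FractalCarrierData k) (m : ℕ) :
    IsUniformlyLipschitzOn (fun t (z : EuclideanSpace ℝ (Fin 3)) => D.level m t (proj z)) univ :=
  IsUniformlyLipschitzOn.of_lipschitzWith (fun z => (continuous_level_proj D m z).continuousOn)
    fun t _ => lipschitzWith_level_proj D m t

/-- The lifted level field is bounded: `‖level m t (proj z)‖ ≤ k a_m / (2π N_m)`. [folklore] -/
theorem norm_level_proj_le (D : FractalCarrierData k) (m : ℕ) (t : ℝ) (z : EuclideanSpace ℝ (Fin 3)) :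
    ‖D.level m t (proj z)‖ ≤ k * D.a m / (2 * Real.pi * D.N m) :=
  norm_level_le D m t (proj z)

/-- An envelope-weighted sum of lifted layers with AFFINE-in-time weights is jointly smooth in `(t, z)`. [folklore] -/
theorem contDiff_affine_layer_sum (D : FractalCarrierData k) (m : ℕ) (α β : Fin k → ℝ) {n : ℕ∞} :
    ContDiff ℝ n fun p : ℝ × EuclideanSpace ℝ (Fin 3) => (D.a m / (D.N m : ℝ)) • ∑ j, (α j + β j * p.1) •
      ((D.word m).phase j).layer (D.N m • proj p.2) := by
  have hterm : ∀ j, ContDiff ℝ n fun p : ℝ × EuclideanSpace ℝ (Fin 3) => (α j + β j * p.1) •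
      ((D.word m).phase j).layer (D.N m • proj p.2) := by
    intro j
    have h1 : ContDiff ℝ n fun p : ℝ × EuclideanSpace ℝ (Fin 3) => α j + β j * p.1 := by fun_prop
    have h2 : ContDiff ℝ n fun p : ℝ × EuclideanSpace ℝ (Fin 3) => ((D.word m).phase j).layer (D.N m • proj p.2) := by
      have hs := isSmooth_layer_nsmul ((D.word m).phase j) (D.N m)
      unfold IsSmooth Torus.lift at hs
      exact (hs.of_le (by exact_mod_cast le_top)).comp contDiff_snd
    exact h1.smul h2
  have hsum : ContDiff ℝ n fun p : ℝ × EuclideanSpace ℝ (Fin 3) => ∑ j, (α j + β j * p.1) •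
      ((D.word m).phase j).layer (D.N m • proj p.2) := ContDiff.sum fun j _ => hterm j
  exact hsum.const_smul (D.a m / (D.N m : ℝ))

/-- **One-sided smooth time slabs around every time.** For every `r` there is `ε > 0` such that the lifted level field is
`C^n` on `[r, r + ε] × ℝ³` and on `[r − ε, r] × ℝ³` (the envelopes are affine there). [folklore] -/
theorem exists_contDiffOn_slabs_level_proj (D : FractalCarrierData k) (m : ℕ) {n : ℕ∞} (r : ℝ) :
    ∃ ε > 0, ContDiffOn ℝ n (uncurry fun t (z : EuclideanSpace ℝ (Fin 3)) => D.level m t (proj z))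
        (Icc r (r + ε) ×ˢ univ) ∧
      ContDiffOn ℝ n (uncurry fun t (z : EuclideanSpace ℝ (Fin 3)) => D.level m t (proj z))
        (Icc (r - ε) r ×ˢ univ) := by
  obtain ⟨ε₁, hε₁, α₁, β₁, h₁⟩ := exists_affine_envelopes_right (D.word m) (D.a_pos m) r
  obtain ⟨ε₂, hε₂, α₂, β₂, h₂⟩ := exists_affine_envelopes_left (D.word m) (D.a_pos m) r
  refine ⟨min ε₁ ε₂, lt_min hε₁ hε₂, ?_, ?_⟩
  · refine (contDiff_affine_layer_sum D m α₁ β₁).contDiffOn.congr fun p hp => ?_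
    have hp1 : p.1 ∈ Icc r (r + ε₁) := ⟨hp.1.1, le_trans hp.1.2 (by linarith [min_le_left ε₁ ε₂])⟩
    simp only [uncurry, level_proj_eq_sum]
    congr 1
    exact Finset.sum_congr rfl fun j _ => by rw [h₁ p.1 hp1 j]
  · refine (contDiff_affine_layer_sum D m α₂ β₂).contDiffOn.congr fun p hp => ?_
    have hp1 : p.1 ∈ Icc (r - ε₂) r := ⟨le_trans (by linarith [min_le_right ε₁ ε₂]) hp.1.1, hp.1.2⟩
    simp only [uncurry, level_proj_eq_sum]
    congr 1
    exact Finset.sum_congr rfl fun j _ => by rw [h₂ p.1 hp1 j]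

/-- The set of times around which the lifted level field is NOT smooth on a two-sided slab has no accumulation: every
time `r` has a punctured neighbourhood of two-sided-smooth times (inside the one-sided slabs at `r`). [folklore] -/
theorem exists_two_sided_slab_near_level_proj (D : FractalCarrierData k) (m : ℕ) {n : ℕ∞} (r : ℝ) :
    ∃ ε > 0, ∀ t, t ≠ r → dist t r < ε → ∃ δ > 0,
      ContDiffOn ℝ n (uncurry fun t (z : EuclideanSpace ℝ (Fin 3)) => D.level m t (proj z))
        (Icc (t - δ) (t + δ) ×ˢ univ) := by
  obtain ⟨ε, hε, hR, hL⟩ := exists_contDiffOn_slabs_level_proj D m (n := n) r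
  refine ⟨ε, hε, fun t htr htd => ?_⟩
  rw [Real.dist_eq, abs_lt] at htd
  rcases lt_or_gt_of_ne htr with hlt | hgt
  · -- `t < r`: inside the left slab
    refine ⟨min (r - t) (t - (r - ε)), lt_min (by linarith) (by linarith), hL.mono (prod_mono (Icc_subset_Icc ?_ ?_) le_rfl)⟩
    · linarith [min_le_right (r - t) (t - (r - ε))]
    · linarith [min_le_left (r - t) (t - (r - ε))]
  · refine ⟨min (t - r) (r + ε - t), lt_min (by linarith) (by linarith), hR.mono (prod_mono (Icc_subset_Icc ?_ ?_) le_rfl)⟩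
    · linarith [min_le_left (t - r) (r + ε - t)]
    · linarith [min_le_right (t - r) (r + ε - t)]

end Summit.AnomalousDissipation.AnomalousDissipation.Theorems.SolenoidalFractalHomogenisation.LagrangianCarrierConstruction

end
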